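import Summits.SmoothPoincare4.SmoothPoincare4.Theses.CongruenceShadows
import Literature.Topology.FourManifolds.SurfaceGroupGenusOne

/-!
# Disproof work file — crux `CongruenceShadows.HeegaardHandlebodyCongruenceClosed` (stmt-SmoothPoincare4-14596)

Standing adversary's Lean record (cdisprove seat `refuter-cdisprove-stmt-SmoothPoincare4-14596-0`).
Everything below is `sorry`-free unless marked NEAR-MISS. Read the crux as: with `S = S_{3+3m}`,
`N = s4Kernels.stabilizeIter m`, `A∩B = Stab N₀ ∩ Stab N₁`, `C = Stab N₂` (subgroups of `Aut S`),
`K_M = ker (Aut S → Aut (S/M))`, the product set `P = (A∩B)·C` is congruence-closed: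
`⋂_{M char, f.i.} P·K_M = P` (`crux_iff`, `InGate` = membership of `P`, `InGateMod ρ M` = membership
of `P·K_M`).

## Findings (index)

1. **Elaboration / vacuity.** rc 0; body `rfl`-equal to the `InGate`/`InGateMod` reformulation
   (`crux_iff`). Hypothesis satisfiable (`inGate_refl`, `inGateMod_of_inGate`); `M = ⊥` excluded (`S`
   infinite) and dropping `FiniteIndex` makes the crux trivially TRUE (`cruxWithoutFiniteIndex_holds`) —
   all content sits in the restriction to finite-index levels. Conclusion NOT universal:
   `not_conclusionUniversal` (`ρ₀ ∉ P`, genus 3, certified).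
2. **Anatomy of a counterexample (all `m`).** `inGate_iff`: `ρ ∈ P ⟺ ∃ x ∈ A∩B, x N₂ = ρ N₂`.
   `tripleJoin_eq_top_of_inGate`: `ρ ∈ P ⇒ N₀ ⊔ N₁ ⊔ ρN₂ = ⊤`.
   `tripleJoin_sup_eq_top_of_inGateMod`: `ρ ∈ P·K_M (M normal) ⇒ (N₀ ⊔ N₁ ⊔ ρN₂) ⊔ M = ⊤`.
   Hence a counterexample `ρ ∈ P̄ ∖ P` carries a twisted triple `(N₀, N₁, ρN₂)` whose triple quotient
   `G_ρ` is killed by every characteristic finite-index level (profinitely trivial) — on paper (residual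
   finiteness of 3-manifold groups, `cd(F̂_k)=1`, Perelman, Waldhausen) its three pairs are standard, so it
   is a `(3+3m; m+1)` group trisection of a group `G` with `Ĝ = 1`: an exotic `S⁴`, or a non-standard
   balanced trisection of `S⁴` (MSZ "4-d Waldhausen"), or a homology 4-sphere with perfect, profinitely
   trivial `π₁` (Kervaire's sphere on Higman's group) — and in every case the hypothesis (pointwise
   congruence at EVERY level) is a BLIND-type statement no finite computation decides. This is why the
   crux resists a kill: it has SPC4 ∧ 4-d-Waldhausen strength on its locus (planner tag `open-problem`
   is right) and no Lean-constructible counterexample is in sight.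
3. **Refuted natural strengthenings (genus 3, `m = 0`, fully certified).**
   * `not_conclusionUniversal`: `P ≠ Aut S₃` — witness `ρ₀` = quarter rotation of handle 0
     (`a₀ ↦ a₀b₀a₀⁻¹, b₀ ↦ a₀⁻¹`), `S₃/(N₁ ⊔ ρ₀N₂) = F₂`.
   * `not_singleLevelSuffices` / `not_levelTwoSuffices`: ONE level never suffices, not even the mod-2
     homology level `M₂ = ker(S₃ → H₁(S₃;𝔽₂))` (characteristic, finite index: `M2_characteristic`,
     `M2_finiteIndex`): `ρ₁ = θ²`, `θ` the Dehn twist about the `(1,1)`-curve of handle 1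
     (`a₁ ↦ a₁b₁a₁, b₁ ↦ a₁⁻¹`), is `≡ id (mod M₂)` (`rho1_congr_M2`) but `ρ₁ ∉ P` (`not_inGate_rho1`:
     `S₃/(N₁ ⊔ ρ₁N₂) = ℤ/3 ∗ ℤ ↠ Sym(3)`, i.e. the re-glued 3-manifold is `L(3,1) # S¹×S²`).
   * `not_someLevelSuffices` (UNIFORM form): NO level at all suffices — for EVERY characteristic
     finite-index `M ≤ S₃` the power `θ^{2d}` (`d` = order of `θ` acting on `S₃/M`, via
     `QuotientGroup.congr`) is `≡ id (mod M)` and lies outside `P` (`exists_congr_not_inGate`, uniform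
     dihedral certificate `S₃ → D_{2d+1}`, `a₁ ↦ r 1`, `b₂ ↦ sr 0`, along `θ^k(a₁) ↦ r(k+1)`): the gate
     has EMPTY INTERIOR in the congruence topology of `Aut S₃`.
   * Certificate engine: `not_inGate_zero_of_cert` — a hom `S₃ → Q` killing the generators of `N₁` and of
     `ρN₂` with two non-commuting values proves `ρ ∉ P` (because `S₃/(N₁ ⊔ N₂) ≅ ℤ` is abelian,
     `commute_of_kills`). Reusable by BLIND-crux (`ShadowsStandard`) refuters.
4. **Known true rungs (not formalised here).** Abelian SHADOW statement is true (prior crux-attack,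
   class number one of the split torus in `GSp₆(ℤ)`); each factor `A∩B`, `C` is congruence-closed
   (separability of `N_i`: `S/N_i` free, residually finite). So a counterexample lives strictly below the
   abelian level and must solve a Torelli-type lifting problem at every level simultaneously.
5. **Johnson-kernel witness (genus 3, fully certified): no family of ABELIAN or CLASS-2 NILPOTENT levels
   suffices.** `not_torelliSuffices`, `not_johnsonKernelSuffices`, `not_classTwoLevelsSuffice`: the
   separating twist `ρ₂ = ψ ∘ T_{δ₀} ∘ ψ⁻¹ = T_{ψ(δ₀)}` (`ψ = T_B ∘ T_A⁻¹`, where `T_A`, `T_B` are the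
   Dehn twists along curves of class `a₀+a₁`, `b₀+b₁` joining handles 0 and 1 — found by a
   Whitehead-graph search for the stabiliser of the cyclic word `[a₀,b₀][a₁,b₁]`, normalised to fix it
   on the nose) satisfies `ρ₂ s · s⁻¹ ∈ γ₃(S₃)` for all `s` (`rho2_congr_gamma3`: it lies in the JOHNSON
   KERNEL, a fortiori in the Torelli group), hence `ρ₂ ∈ P·K_M` (with `x = c = 1`) for EVERY level
   `M ⊇ γ₃ S₃` — every characteristic finite-index `M` with `S₃/M` nilpotent of class ≤ 2, in particular
   every abelian level — and yet `ρ₂ ∉ P` (`not_inGate_rho2`, certificate `cert2` into `Sym(3)` through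
   the pair `(N₀, ρ₂N₂)`: the re-glued 3-manifold is a homology `S¹×S²` with a `Sym(3)` quotient, of
   `0`-surgery-on-a-trefoil type). MORAL FOR PROVERS: any proof must use levels whose quotients are NOT
   class-≤2 nilpotent (compare the abelian SHADOW statement, which is TRUE): the content of the crux
   starts at nilpotency class 3 / non-nilpotent (soluble, simple) quotients, simultaneously over all of
   them. Next rungs (open here): depth-4 Johnson elements `[ρ₂, ρ₂']` have no `Sym(3)…A₅` certificate
   through either pair (py/deeper.py) — is `P` closed in the pro-nilpotent topology? (Hain 2008 §10 is
   the unipotent precedent for single stabilisers.)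

Literature: Leininger–McReynolds (arXiv:math/0505225) Cor 1.4 = separability of each factor only; no
double-coset separability theorem for `Mod(Σ_g)`/`Aut S_g` in print; CSP for `Mod_g`, `g ≥ 3`, open
(Wilton arXiv:2410.00556 conditional). `lit` searchd was unavailable (rc 75) during this cycle.
-/

set_option linter.dupNamespace false

namespace Summit.SmoothPoincare4.SmoothPoincare4.Cruxes.HeegaardHandlebodyCongruenceClosed.Disproof

open Literature.Topology.FourManifolds Subgroup

/-- `S m = S_{3+3m}`. -/
abbrev S (m : ℕ) : Type := SurfaceGroup (3 + 3 * m)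

/-- `N m` = the standard `S⁴` kernel triple of genus `3+3m`. -/
abbrev N (m : ℕ) : TrisectionKernels (3 + 3 * m) := s4Kernels.stabilizeIter m

/-- `x` stabilises `N m i`. -/
def Stab (m : ℕ) (i : Fin 3) (x : S m ≃* S m) : Prop := (N m i).map x.toMonoidHom = N m i

/-- `ρ ∈ (A∩B)·C` (the "gate"). -/
def InGate (m : ℕ) (ρ : S m ≃* S m) : Prop :=
  ∃ x c : S m ≃* S m, Stab m 0 x ∧ Stab m 1 x ∧ Stab m 2 c ∧ ∀ s, ρ s = x (c s)

/-- `ρ ∈ (A∩B)·C·K_M` : congruent mod `M` to a gate element. -/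
def InGateMod (m : ℕ) (ρ : S m ≃* S m) (M : Subgroup (S m)) : Prop :=
  ∃ x c : S m ≃* S m, Stab m 0 x ∧ Stab m 1 x ∧ Stab m 2 c ∧ ∀ s, ρ s * (x (c s))⁻¹ ∈ M

theorem crux_iff :
    Theses.CongruenceShadows.HeegaardHandlebodyCongruenceClosed ↔
      ∀ (m : ℕ) (ρ : S m ≃* S m),
        (∀ M : Subgroup (S m), M.Characteristic → M.FiniteIndex → InGateMod m ρ M) → InGate m ρ :=
  Iff.rfl

/-- The standard triple is a group trisection of the trivial group at every genus `3+3m`. -/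
theorem N_isGroupTrisection (m : ℕ) : IsGroupTrisection (3 + 3 * m) (m + 1) (PUnit : Type) (N m) := by
  induction m with
  | zero => exact s4Kernels_isGroupTrisection_holds
  | succ m ih => exact stabilize_isGroupTrisection_holds _ _ _ _ ih

instance N_normal (m : ℕ) (i : Fin 3) : (N m i).Normal := (N_isGroupTrisection m).normal i

/-- The triple join of the standard kernels is everything (triple quotient trivial). -/
theorem normalClosure_iUnion_N (m : ℕ) : normalClosure (⋃ i, (N m i : Set (S m))) = ⊤ := by
  obtain ⟨e⟩ := (N_isGroupTrisection m).triple
  haveI : Subsingleton (N m).tripleQuotient := e.toEquiv.subsingleton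
  rw [eq_top_iff]
  intro g _
  exact (QuotientGroup.eq_one_iff g).1 (Subsingleton.elim _ _)

/-- `map` along a composite automorphism. -/
theorem map_trans {m : ℕ} (H : Subgroup (S m)) (e₁ e₂ : S m ≃* S m) :
    H.map (e₁.trans e₂).toMonoidHom = (H.map e₁.toMonoidHom).map e₂.toMonoidHom := by
  rw [Subgroup.map_map]; rfl

instance map_N_normal (m : ℕ) (i : Fin 3) (ρ : S m ≃* S m) : ((N m i).map ρ.toMonoidHom).Normal :=
  Subgroup.Normal.map inferInstance _ ρ.surjective

/-- gate membership as a statement about the image of `N₂`. -/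
theorem inGate_iff (m : ℕ) (ρ : S m ≃* S m) :
    InGate m ρ ↔ ∃ x : S m ≃* S m, Stab m 0 x ∧ Stab m 1 x ∧
      (N m 2).map x.toMonoidHom = (N m 2).map ρ.toMonoidHom := by
  constructor
  · rintro ⟨x, c, h0, h1, h2, h⟩
    refine ⟨x, h0, h1, ?_⟩
    have hρ : ρ = c.trans x := MulEquiv.ext fun s => by simpa using h s
    rw [hρ, map_trans, h2]
  · rintro ⟨x, h0, h1, h2⟩
    refine ⟨x, ρ.trans x.symm, h0, h1, ?_, fun s => by simp⟩
    show (N m 2).map (ρ.trans x.symm).toMonoidHom = N m 2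
    rw [map_trans, ← h2, ← map_trans]
    simp

/-- pointwise congruence moves the image of `N₂` only within `M`. -/
theorem map_sup_eq_of_congr {m : ℕ} {ρ x c : S m ≃* S m} {M : Subgroup (S m)}
    (h : ∀ s, ρ s * (x (c s))⁻¹ ∈ M) (H : Subgroup (S m)) :
    H.map ρ.toMonoidHom ⊔ M = (H.map c.toMonoidHom).map x.toMonoidHom ⊔ M := by
  apply le_antisymm
  · refine sup_le ?_ le_sup_right
    rintro _ ⟨s, hs, rfl⟩
    have : ρ s = (ρ s * (x (c s))⁻¹) * x (c s) := by group
    rw [MulEquiv.coe_toMonoidHom, this]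
    exact mul_mem (mem_sup_right (h s)) (mem_sup_left ⟨c s, ⟨s, hs, rfl⟩, rfl⟩)
  · refine sup_le ?_ le_sup_right
    rintro _ ⟨_, ⟨s, hs, rfl⟩, rfl⟩
    have : x (c s) = (ρ s * (x (c s))⁻¹)⁻¹ * ρ s := by group
    rw [MulEquiv.coe_toMonoidHom, MulEquiv.coe_toMonoidHom, this]
    exact mul_mem (mem_sup_right (inv_mem (h s))) (mem_sup_left ⟨s, hs, rfl⟩)

/-- The `ρ`-twisted triple `(N₀, N₁, ρ N₂)`. -/
def twisted (m : ℕ) (ρ : S m ≃* S m) : TrisectionKernels (3 + 3 * m) :=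
  ![N m 0, N m 1, (N m 2).map ρ.toMonoidHom]

/-- the normal closure of the twisted triple -/
abbrev tripleJoin (m : ℕ) (ρ : S m ≃* S m) : Subgroup (S m) :=
  N m 0 ⊔ N m 1 ⊔ (N m 2).map ρ.toMonoidHom

theorem tripleJoin_eq_top_of_carrier {m : ℕ} {ρ x : S m ≃* S m} (h0 : Stab m 0 x) (h1 : Stab m 1 x)
    (h2 : (N m 2).map x.toMonoidHom = (N m 2).map ρ.toMonoidHom) : tripleJoin m ρ = ⊤ := by
  have hx : Function.Surjective x.toMonoidHom := x.surjective
  have key : (⊤ : Subgroup (S m)).map x.toMonoidHom ≤ tripleJoin m ρ := by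
    rw [← normalClosure_iUnion_N m, map_normalClosure _ _ hx]
    refine normalClosure_le_normal ?_
    rintro _ ⟨s, hs, rfl⟩
    simp only [Set.mem_iUnion, SetLike.mem_coe] at hs
    obtain ⟨i, hi⟩ := hs
    fin_cases i
    · exact mem_sup_left (mem_sup_left (h0.le ⟨s, hi, rfl⟩))
    · exact mem_sup_left (mem_sup_right (h1.le ⟨s, hi, rfl⟩))
    · exact mem_sup_right (h2.le ⟨s, hi, rfl⟩)
  rw [eq_top_iff]
  refine le_trans ?_ key
  rw [← MonoidHom.range_eq_map, MonoidHom.range_eq_top.2 hx]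

/-- NECESSARY CONDITION 1: a gate element has trivial twisted triple quotient. -/
theorem tripleJoin_eq_top_of_inGate {m : ℕ} {ρ : S m ≃* S m} (h : InGate m ρ) : tripleJoin m ρ = ⊤ := by
  obtain ⟨x, h0, h1, h2⟩ := (inGate_iff m ρ).1 h
  exact tripleJoin_eq_top_of_carrier h0 h1 h2

/-- NECESSARY CONDITION 2: congruent to a gate element mod a normal `M` ⇒ triple quotient dies mod `M`. -/
theorem tripleJoin_sup_eq_top_of_inGateMod {m : ℕ} {ρ : S m ≃* S m} {M : Subgroup (S m)} [M.Normal]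
    (h : InGateMod m ρ M) : tripleJoin m ρ ⊔ M = ⊤ := by
  obtain ⟨x, c, h0, h1, h2, h⟩ := h
  have hx : Function.Surjective x.toMonoidHom := x.surjective
  have e2 : (N m 2).map ρ.toMonoidHom ⊔ M = (N m 2).map x.toMonoidHom ⊔ M := by
    rw [map_sup_eq_of_congr h, h2]
  have key : (⊤ : Subgroup (S m)).map x.toMonoidHom ≤ tripleJoin m ρ ⊔ M := by
    rw [← normalClosure_iUnion_N m, map_normalClosure _ _ hx]
    refine normalClosure_le_normal ?_
    rintro _ ⟨s, hs, rfl⟩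
    simp only [Set.mem_iUnion, SetLike.mem_coe] at hs
    obtain ⟨i, hi⟩ := hs
    fin_cases i
    · exact mem_sup_left (mem_sup_left (mem_sup_left (h0.le ⟨s, hi, rfl⟩)))
    · exact mem_sup_left (mem_sup_left (mem_sup_right (h1.le ⟨s, hi, rfl⟩)))
    · have : x.toMonoidHom s ∈ (N m 2).map ρ.toMonoidHom ⊔ M := by
        rw [e2]; exact mem_sup_left ⟨s, hi, rfl⟩
      simp only [tripleJoin]
      -- reassociate: (A ⊔ B ⊔ C) ⊔ M ≥ C ⊔ M
      exact (sup_le_sup_right le_sup_right M) this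
  rw [eq_top_iff]
  refine le_trans ?_ key
  rw [← MonoidHom.range_eq_map, MonoidHom.range_eq_top.2 hx]

/-- contrapositive certificate: a nontrivial twisted triple quotient keeps `ρ` out of the gate. -/
theorem not_inGate_of_tripleJoin_ne_top {m : ℕ} {ρ : S m ≃* S m} (h : tripleJoin m ρ ≠ ⊤) :
    ¬ InGate m ρ := fun hρ => h (tripleJoin_eq_top_of_inGate hρ)

/-- non-vacuity: gate elements satisfy the hypothesis at every `M`. -/
theorem inGateMod_of_inGate {m : ℕ} {ρ : S m ≃* S m} (h : InGate m ρ) (M : Subgroup (S m)) :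
    InGateMod m ρ M := by
  obtain ⟨x, c, h0, h1, h2, h⟩ := h
  exact ⟨x, c, h0, h1, h2, fun s => by simp [h s]⟩

theorem inGate_refl (m : ℕ) : InGate m (MulEquiv.refl _) :=
  ⟨MulEquiv.refl _, MulEquiv.refl _, by simp [Stab], by simp [Stab], by simp [Stab], fun s => rfl⟩

/-- LOAD-BEARING (M-family): dropping `FiniteIndex` makes the crux trivially true (`M = ⊥`). -/
def CruxWithoutFiniteIndex : Prop :=
  ∀ (m : ℕ) (ρ : S m ≃* S m), (∀ M : Subgroup (S m), M.Characteristic → InGateMod m ρ M) → InGate m ρ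

theorem cruxWithoutFiniteIndex_holds : CruxWithoutFiniteIndex := by
  intro m ρ h
  obtain ⟨x, c, h0, h1, h2, h⟩ := h ⊥ inferInstance
  exact ⟨x, c, h0, h1, h2, fun s => mul_inv_eq_one.1 ((mem_bot).1 (h s))⟩

/-- Monotonicity in `M`. -/
theorem InGateMod.mono {m : ℕ} {ρ : S m ≃* S m} {M M' : Subgroup (S m)} (hle : M ≤ M')
    (h : InGateMod m ρ M) : InGateMod m ρ M' := by
  obtain ⟨x, c, h0, h1, h2, h⟩ := h
  exact ⟨x, c, h0, h1, h2, fun s => hle (h s)⟩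


/-! ## Genus 3 (`m = 0`): explicit automorphisms and non-gate certificates -/

section GenusThree

open SurfaceGroup

/-- the surface relator of genus 3, unfolded -/
theorem surfaceRelator_three : surfaceRelator 3 =
    (genA 0 * genB 0 * (genA 0)⁻¹ * (genB 0)⁻¹) *
    ((genA 1 * genB 1 * (genA 1)⁻¹ * (genB 1)⁻¹) *
    ((genA 2 * genB 2 * (genA 2)⁻¹ * (genB 2)⁻¹))) := by
  have : List.finRange 3 = [0, 1, 2] := by decide
  simp [surfaceRelator, this, mul_assoc]

/-- fold generators of `S₃` into the `a`/`b` notation -/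
theorem of_false (i : Fin 3) :
    (PresentedGroup.of (i, false) : SurfaceGroup 3) = a i := rfl
theorem of_true (i : Fin 3) :
    (PresentedGroup.of (i, true) : SurfaceGroup 3) = b i := rfl

/-- the defining relation of `S₃` -/
theorem rel_three : (a 0 * b 0 * (a 0)⁻¹ * (b 0)⁻¹) * ((a 1 * b 1 * (a 1)⁻¹ * (b 1)⁻¹) *
    (a 2 * b 2 * (a 2)⁻¹ * (b 2)⁻¹)) = (1 : SurfaceGroup 3) := by
  have hw : (a 0 * b 0 * (a 0)⁻¹ * (b 0)⁻¹) * ((a 1 * b 1 * (a 1)⁻¹ * (b 1)⁻¹) *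
      (a 2 * b 2 * (a 2)⁻¹ * (b 2)⁻¹)) = PresentedGroup.mk ({surfaceRelator 3} : Set _)
      ((genA 0 * genB 0 * (genA 0)⁻¹ * (genB 0)⁻¹) *
      ((genA 1 * genB 1 * (genA 1)⁻¹ * (genB 1)⁻¹) *
      ((genA 2 * genB 2 * (genA 2)⁻¹ * (genB 2)⁻¹)))) := by
    simp [SurfaceGroup.a, SurfaceGroup.b, PresentedGroup.of, genA, genB]
  rw [hw, ← surfaceRelator_three]
  exact SurfaceGroup.mk_surfaceRelator

/-- a hom out of `S₃` from generator images killing the relator -/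
def liftHom {Q : Type*} [Group Q] (f : surfaceGen 3 → Q) (h : FreeGroup.lift f (surfaceRelator 3) = 1) :
    SurfaceGroup 3 →* Q :=
  PresentedGroup.toGroup (f := f) (by
    intro r hr
    rw [Set.mem_singleton_iff] at hr
    subst hr
    exact h)

@[simp] theorem liftHom_of {Q : Type*} [Group Q] (f : surfaceGen 3 → Q) (h) (p : surfaceGen 3) :
    liftHom f h (PresentedGroup.of p) = f p := PresentedGroup.toGroup.of _

@[simp] theorem liftHom_a {Q : Type*} [Group Q] (f : surfaceGen 3 → Q) (h) (i : Fin 3) :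
    liftHom f h (a i) = f (i, false) := PresentedGroup.toGroup.of _

@[simp] theorem liftHom_b {Q : Type*} [Group Q] (f : surfaceGen 3 → Q) (h) (i : Fin 3) :
    liftHom f h (b i) = f (i, true) := PresentedGroup.toGroup.of _

/-- evaluate the lifted relator from generator images -/
theorem lift_surfaceRelator_three {Q : Type*} [Group Q] (f : surfaceGen 3 → Q) :
    FreeGroup.lift f (surfaceRelator 3) =
      (f (0, false) * f (0, true) * (f (0, false))⁻¹ * (f (0, true))⁻¹) *
      ((f (1, false) * f (1, true) * (f (1, false))⁻¹ * (f (1, true))⁻¹) *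
      (f (2, false) * f (2, true) * (f (2, false))⁻¹ * (f (2, true))⁻¹)) := by
  simp [surfaceRelator_three, genA, genB]

/-! ### `ρ₀`: the quarter-rotation of handle 0 (`a₀ ↦ a₀b₀a₀⁻¹`, `b₀ ↦ a₀⁻¹`) -/

/-- generator images of `ρ₀` -/
def rho0Fun (p : surfaceGen 3) : SurfaceGroup 3 :=
  if p.1 = 0 then (if p.2 then (a 0)⁻¹ else a 0 * b 0 * (a 0)⁻¹) else PresentedGroup.of p

/-- generator images of `ρ₀⁻¹` (`a₀ ↦ b₀⁻¹`, `b₀ ↦ b₀a₀b₀⁻¹`) -/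
def rho0InvFun (p : surfaceGen 3) : SurfaceGroup 3 :=
  if p.1 = 0 then (if p.2 then b 0 * a 0 * (b 0)⁻¹ else (b 0)⁻¹) else PresentedGroup.of p

theorem rho0Fun_rel : FreeGroup.lift rho0Fun (surfaceRelator 3) = 1 := by
  rw [lift_surfaceRelator_three, ← rel_three]
  simp [rho0Fun, of_false, of_true]
  group

theorem rho0InvFun_rel : FreeGroup.lift rho0InvFun (surfaceRelator 3) = 1 := by
  rw [lift_surfaceRelator_three, ← rel_three]
  simp [rho0InvFun, of_false, of_true]
  group

/-- `ρ₀` as a hom -/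
def rho0Hom : SurfaceGroup 3 →* SurfaceGroup 3 := liftHom rho0Fun rho0Fun_rel
/-- `ρ₀⁻¹` as a hom -/
def rho0InvHom : SurfaceGroup 3 →* SurfaceGroup 3 := liftHom rho0InvFun rho0InvFun_rel

theorem rho0Inv_comp : rho0InvHom.comp rho0Hom = MonoidHom.id _ := by
  apply PresentedGroup.ext
  rintro ⟨i, _ | _⟩ <;> fin_cases i <;>
    simp [rho0Hom, rho0InvHom, rho0Fun, rho0InvFun, of_false, of_true]
  all_goals group

theorem rho0_comp_inv : rho0Hom.comp rho0InvHom = MonoidHom.id _ := by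
  apply PresentedGroup.ext
  rintro ⟨i, _ | _⟩ <;> fin_cases i <;>
    simp [rho0Hom, rho0InvHom, rho0Fun, rho0InvFun, of_false, of_true]
  all_goals group

/-- **`ρ₀ ∈ Aut S₃`**: the automorphism induced by the quarter rotation of the first handle
(`a₀ ↦ a₀b₀a₀⁻¹`, `b₀ ↦ a₀⁻¹`, other generators fixed; it fixes `[a₀,b₀]` on the nose). -/
def rho0 : SurfaceGroup 3 ≃* SurfaceGroup 3 := MonoidHom.toMulEquiv rho0Hom rho0InvHom rho0Inv_comp rho0_comp_inv

@[simp] theorem rho0_a0 : rho0 (a 0) = a 0 * b 0 * (a 0)⁻¹ := by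
  simp [rho0, rho0Hom, rho0Fun]
@[simp] theorem rho0_b0 : rho0 (b 0) = (a 0)⁻¹ := by
  simp [rho0, rho0Hom, rho0Fun]
@[simp] theorem rho0_a1 : rho0 (a 1) = a 1 := by
  simp [rho0, rho0Hom, rho0Fun, of_false]
@[simp] theorem rho0_a2 : rho0 (a 2) = a 2 := by
  simp [rho0, rho0Hom, rho0Fun, of_false]
@[simp] theorem rho0_b1 : rho0 (b 1) = b 1 := by
  simp [rho0, rho0Hom, rho0Fun, of_true]
@[simp] theorem rho0_b2 : rho0 (b 2) = b 2 := by
  simp [rho0, rho0Hom, rho0Fun, of_true]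

/-! ### `θ`: the Dehn twist about the `(1,1)`-curve of handle 1 (`a₁ ↦ a₁b₁a₁`, `b₁ ↦ a₁⁻¹`) -/

/-- generator images of `θ` -/
def thetaFun (p : surfaceGen 3) : SurfaceGroup 3 :=
  if p.1 = 1 then (if p.2 then (a 1)⁻¹ else a 1 * b 1 * a 1) else PresentedGroup.of p

/-- generator images of `θ⁻¹` (`a₁ ↦ b₁⁻¹`, `b₁ ↦ b₁a₁b₁`) -/
def thetaInvFun (p : surfaceGen 3) : SurfaceGroup 3 :=
  if p.1 = 1 then (if p.2 then b 1 * a 1 * b 1 else (b 1)⁻¹) else PresentedGroup.of p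

theorem thetaFun_rel : FreeGroup.lift thetaFun (surfaceRelator 3) = 1 := by
  rw [lift_surfaceRelator_three, ← rel_three]
  simp [thetaFun, of_false, of_true]
  group

theorem thetaInvFun_rel : FreeGroup.lift thetaInvFun (surfaceRelator 3) = 1 := by
  rw [lift_surfaceRelator_three, ← rel_three]
  simp [thetaInvFun, of_false, of_true]
  group

/-- `θ` as a hom -/
def thetaHom : SurfaceGroup 3 →* SurfaceGroup 3 := liftHom thetaFun thetaFun_rel
/-- `θ⁻¹` as a hom -/
def thetaInvHom : SurfaceGroup 3 →* SurfaceGroup 3 := liftHom thetaInvFun thetaInvFun_rel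

theorem thetaInv_comp : thetaInvHom.comp thetaHom = MonoidHom.id _ := by
  apply PresentedGroup.ext
  rintro ⟨i, _ | _⟩ <;> fin_cases i <;>
    simp [thetaHom, thetaInvHom, thetaFun, thetaInvFun, of_false, of_true]
  all_goals group

theorem theta_comp_inv : thetaHom.comp thetaInvHom = MonoidHom.id _ := by
  apply PresentedGroup.ext
  rintro ⟨i, _ | _⟩ <;> fin_cases i <;>
    simp [thetaHom, thetaInvHom, thetaFun, thetaInvFun, of_false, of_true]
  all_goals group

/-- **`θ ∈ Aut S₃`**: the Dehn twist about the simple closed curve of slope `(1,1)` on the second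
handle (`a₁ ↦ a₁b₁a₁`, `b₁ ↦ a₁⁻¹`; fixes `[a₁,b₁]` on the nose; acts on `H₁` by `a₁ ↦ 2a₁+b₁`,
`b₁ ↦ -a₁`, the symplectic transvection along `a₁+b₁`). -/
def theta : SurfaceGroup 3 ≃* SurfaceGroup 3 :=
  MonoidHom.toMulEquiv thetaHom thetaInvHom thetaInv_comp theta_comp_inv

@[simp] theorem theta_a1 : theta (a 1) = a 1 * b 1 * a 1 := by
  simp [theta, thetaHom, thetaFun]
@[simp] theorem theta_b1 : theta (b 1) = (a 1)⁻¹ := by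
  simp [theta, thetaHom, thetaFun]
@[simp] theorem theta_a0 : theta (a 0) = a 0 := by
  simp [theta, thetaHom, thetaFun, of_false]
@[simp] theorem theta_a2 : theta (a 2) = a 2 := by
  simp [theta, thetaHom, thetaFun, of_false]
@[simp] theorem theta_b0 : theta (b 0) = b 0 := by
  simp [theta, thetaHom, thetaFun, of_true]
@[simp] theorem theta_b2 : theta (b 2) = b 2 := by
  simp [theta, thetaHom, thetaFun, of_true]

/-- **`ρ₁ = θ²`**, the square of the `(1,1)`-twist: trivial on `H₁(S₃; 𝔽₂)`. -/
def rho1 : SurfaceGroup 3 ≃* SurfaceGroup 3 := theta.trans theta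

@[simp] theorem rho1_a1 : rho1 (a 1) = a 1 * b 1 * a 1 * b 1 * a 1 := by
  simp [rho1]; group
@[simp] theorem rho1_b1 : rho1 (b 1) = (a 1)⁻¹ * (b 1)⁻¹ * (a 1)⁻¹ := by
  simp [rho1]; group
@[simp] theorem rho1_a0 : rho1 (a 0) = a 0 := by simp [rho1]
@[simp] theorem rho1_a2 : rho1 (a 2) = a 2 := by simp [rho1]
@[simp] theorem rho1_b0 : rho1 (b 0) = b 0 := by simp [rho1]
@[simp] theorem rho1_b2 : rho1 (b 2) = b 2 := by simp [rho1]

/-! ### Non-gate certificates at genus 3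

If `ρ = x ∘ c` with `x ∈ Stab N₀ ∩ Stab N₁`, `c ∈ Stab N₂`, then `x` carries the pair `(N₁, N₂)`
onto `(N₁, ρN₂)`, so `S₃ ⧸ (N₁ ⊔ ρN₂) ≅ S₃ ⧸ (N₁ ⊔ N₂) = ⟨b₂⟩ ≅ ℤ` is **abelian**. A hom `f` to any
group killing `N₁` and `ρ N₂` with two non-commuting values therefore certifies `ρ ∉ (A∩B)·C`. -/

/-- at genus 3, a hom killing `a₀, b₀, a₁, b₁, a₂` (i.e. `N₁ ⊔ N₂`) has abelian image -/
theorem commute_of_kills {Q : Type*} [Group Q] (φ : SurfaceGroup 3 →* Q)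
    (h1 : φ (a 0) = 1) (h2 : φ (b 0) = 1) (h3 : φ (a 1) = 1) (h4 : φ (b 1) = 1) (h5 : φ (a 2) = 1)
    (s t : SurfaceGroup 3) : φ s * φ t = φ t * φ s := by
  let ε : SurfaceGroup 3 →* Multiplicative ℤ :=
    SurfaceGroup.toCommGroup (fun p => if p = ((2 : Fin 3), true) then Multiplicative.ofAdd 1 else 1)
  have hφ : φ = (zpowersHom Q (φ (b 2))).comp ε := by
    apply PresentedGroup.ext
    rintro ⟨i, _ | _⟩ <;> fin_cases i <;>
      simp [ε, of_false, of_true, h1, h2, h3, h4, h5]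
  rw [hφ]
  simp only [MonoidHom.comp_apply, zpowersHom_apply]
  exact zpow_mul_comm _ _ _

theorem a_mem_s4Kernels_one : (a 0 : SurfaceGroup 3) ∈ s4Kernels 1 :=
  subset_normalClosure (by simp)
theorem b_mem_s4Kernels_one : (b 1 : SurfaceGroup 3) ∈ s4Kernels 1 :=
  subset_normalClosure (by simp)
theorem a_two_mem_s4Kernels_one : (a 2 : SurfaceGroup 3) ∈ s4Kernels 1 :=
  subset_normalClosure (by simp)
theorem b_mem_s4Kernels_two : (b 0 : SurfaceGroup 3) ∈ s4Kernels 2 :=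
  subset_normalClosure (by simp)
theorem a_mem_s4Kernels_two : (a 1 : SurfaceGroup 3) ∈ s4Kernels 2 :=
  subset_normalClosure (by simp)
theorem a_two_mem_s4Kernels_two : (a 2 : SurfaceGroup 3) ∈ s4Kernels 2 :=
  subset_normalClosure (by simp)

/-- **Non-gate certificate (genus 3).** A hom `f : S₃ → Q` killing the generators `a₀, b₁, a₂` of
`N₁` and the generators `ρ b₀, ρ a₁, ρ a₂` of `ρ N₂`, with two non-commuting values, shows
`ρ ∉ (Stab N₀ ∩ Stab N₁)·Stab N₂`. -/
theorem not_inGate_zero_of_cert {Q : Type*} [Group Q] (ρ : SurfaceGroup 3 ≃* SurfaceGroup 3)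
    (f : SurfaceGroup 3 →* Q) (hf0 : f (a 0) = 1) (hf1 : f (b 1) = 1) (hf2 : f (a 2) = 1)
    (hρ0 : f (ρ (b 0)) = 1) (hρ1 : f (ρ (a 1)) = 1) (hρ2 : f (ρ (a 2)) = 1)
    (s t : SurfaceGroup 3) (hne : f s * f t ≠ f t * f s) : ¬ InGate 0 ρ := by
  intro h
  obtain ⟨x, -, h1, h2⟩ := (inGate_iff 0 ρ).1 h
  change (s4Kernels 1).map x.toMonoidHom = s4Kernels 1 at h1
  change (s4Kernels 2).map x.toMonoidHom = (s4Kernels 2).map ρ.toMonoidHom at h2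
  have k1 : s4Kernels 1 ≤ f.ker := by
    refine normalClosure_le_normal ?_
    rintro _ (rfl | rfl | rfl) <;> simpa
  have k2 : (s4Kernels 2).map ρ.toMonoidHom ≤ f.ker := by
    rw [show s4Kernels 2 = normalClosure {b 0, a 1, a 2} from rfl, map_normalClosure _ _ ρ.surjective]
    refine normalClosure_le_normal ?_
    rintro _ ⟨_, (rfl | rfl | rfl), rfl⟩ <;> simpa
  have viaN1 : ∀ g ∈ s4Kernels 1, f (x g) = 1 := fun g hg =>
    k1 (h1.le (mem_map_of_mem x.toMonoidHom hg))
  have viaN2 : ∀ g ∈ s4Kernels 2, f (x g) = 1 := fun g hg =>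
    k2 (h2.le (mem_map_of_mem x.toMonoidHom hg))
  have comm := commute_of_kills (f.comp x.toMonoidHom)
    (viaN1 _ a_mem_s4Kernels_one) (viaN2 _ b_mem_s4Kernels_two) (viaN2 _ a_mem_s4Kernels_two)
    (viaN1 _ b_mem_s4Kernels_one) (viaN1 _ a_two_mem_s4Kernels_one) (x.symm s) (x.symm t)
  exact hne (by simpa using comm)

/-! ### The certificates for `ρ₀` and `ρ₁` (values in the symmetric group `Perm (Fin 3)`) -/

/-- generator images: `b₀ ↦ (0 1 2)`, `b₂ ↦ (0 1)`, all others `↦ 1` -/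
def cert0Fun (p : surfaceGen 3) : Equiv.Perm (Fin 3) :=
  if p = (0, true) then finRotate 3 else if p = (2, true) then Equiv.swap 0 1 else 1

/-- generator images: `a₁ ↦ (0 1 2)`, `b₂ ↦ (0 1)`, all others `↦ 1` -/
def cert1Fun (p : surfaceGen 3) : Equiv.Perm (Fin 3) :=
  if p = (1, false) then finRotate 3 else if p = (2, true) then Equiv.swap 0 1 else 1

theorem cert0Fun_rel : FreeGroup.lift cert0Fun (surfaceRelator 3) = 1 := by
  rw [lift_surfaceRelator_three]; simp [cert0Fun]

theorem cert1Fun_rel : FreeGroup.lift cert1Fun (surfaceRelator 3) = 1 := by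
  rw [lift_surfaceRelator_three]; simp [cert1Fun]

/-- certificate hom for `ρ₀` -/
def cert0 : SurfaceGroup 3 →* Equiv.Perm (Fin 3) := liftHom cert0Fun cert0Fun_rel
/-- certificate hom for `ρ₁` -/
def cert1 : SurfaceGroup 3 →* Equiv.Perm (Fin 3) := liftHom cert1Fun cert1Fun_rel

/-- **`ρ₀ ∉ (A∩B)·C`.** (`S₃ ⧸ (N₁ ⊔ ρ₀N₂) = F⟨b₀, b₂⟩` is free of rank 2, not `ℤ`.) -/
theorem not_inGate_rho0 : ¬ InGate 0 rho0 := by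
  refine not_inGate_zero_of_cert rho0 cert0 ?_ ?_ ?_ ?_ ?_ ?_ (b 0) (b 2) ?_
  iterate 6 simp [cert0, cert0Fun]
  simp only [cert0, liftHom_b]
  decide

/-- **`ρ₁ ∉ (A∩B)·C`.** (`S₃ ⧸ (N₁ ⊔ ρ₁N₂) = ⟨a₁, b₂ ∣ a₁³⟩ ≅ ℤ/3 ∗ ℤ`, the group of
`L(3,1) # S¹×S²`: changing the gluing of the standard genus-3 splitting of `S¹×S²` by `T_c^{2}`,
`c` the `(1,1)`-curve on an `S³`-summand torus, produces a lens-space summand.) -/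
theorem not_inGate_rho1 : ¬ InGate 0 rho1 := by
  refine not_inGate_zero_of_cert rho1 cert1 ?_ ?_ ?_ ?_ ?_ ?_ (a 1) (b 2) ?_
  · simp [cert1, cert1Fun]
  · simp [cert1, cert1Fun]
  · simp [cert1, cert1Fun]
  · simp [cert1, cert1Fun]
  · simp only [rho1_a1, map_mul, cert1, liftHom_a, liftHom_b]
    decide
  · simp [cert1, cert1Fun]
  · simp only [cert1, liftHom_a, liftHom_b]
    decide

/-! ### The level-2 congruence subgroup `M₂ = ker (S₃ → H₁(S₃; 𝔽₂))` -/

/-- homs to `𝔽₂` from generator values -/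
def homZ2 (v : surfaceGen 3 → Multiplicative (ZMod 2)) : SurfaceGroup 3 →* Multiplicative (ZMod 2) :=
  SurfaceGroup.toCommGroup v

/-- `M₂ = [S₃,S₃]·S₃² = ⋂ ker (S₃ → 𝔽₂)`, the mod-2 homology kernel. -/
def M2 : Subgroup (SurfaceGroup 3) := ⨅ v, (homZ2 v).ker

theorem mem_M2 {s : SurfaceGroup 3} : s ∈ M2 ↔ ∀ v, homZ2 v s = 1 := by
  simp [M2, Subgroup.mem_iInf, MonoidHom.mem_ker]

instance M2_finiteIndex : M2.FiniteIndex := Subgroup.finiteIndex_iInf fun _ => inferInstance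

/-- every hom to `𝔽₂` is a `homZ2` -/
theorem eq_homZ2 (f : SurfaceGroup 3 →* Multiplicative (ZMod 2)) :
    f = homZ2 (fun p => f (PresentedGroup.of p)) :=
  PresentedGroup.ext fun p => by simp [homZ2]

theorem M2_characteristic : M2.Characteristic := by
  refine Subgroup.characteristic_iff_le_comap.2 fun φ s hs => ?_
  rw [Subgroup.mem_comap, mem_M2]
  intro v
  have := (mem_M2.1 hs) (fun p => homZ2 v (φ (PresentedGroup.of p)))
  rw [← MonoidHom.comp_apply, eq_homZ2 ((homZ2 v).comp φ.toMonoidHom)]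
  simpa using this

/-- `ρ₁ ≡ id (mod M₂)`: the square of a Dehn twist acts trivially on mod-2 homology. -/
theorem rho1_congr_M2 (s : SurfaceGroup 3) : rho1 s * s⁻¹ ∈ M2 := by
  rw [mem_M2]
  intro v
  suffices h : (homZ2 v).comp rho1.toMonoidHom = homZ2 v by
    have := DFunLike.congr_fun h s
    simp only [MonoidHom.comp_apply, MulEquiv.coe_toMonoidHom] at this
    rw [map_mul, map_inv, this, mul_inv_cancel]
  have sq1 : ∀ p q : Multiplicative (ZMod 2), p * q * p * q * p = p := by decide
  have sq2 : ∀ p q : Multiplicative (ZMod 2), p⁻¹ * q⁻¹ * p⁻¹ = q := by decide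
  apply PresentedGroup.ext
  rintro ⟨i, _ | _⟩ <;> fin_cases i <;> simp [homZ2, of_false, of_true, sq1, sq2]

/-- hence `ρ₁ ∈ (A∩B)·C·K_{M₂}` with `x = c = 1` -/
theorem inGateMod_rho1_M2 : InGateMod 0 rho1 M2 :=
  ⟨MulEquiv.refl _, MulEquiv.refl _, by simp [Stab], by simp [Stab], by simp [Stab],
    fun s => by simpa using rho1_congr_M2 s⟩

/-! ### Refuted natural strengthenings -/

/-- STRENGTHENING 1 (drop the hypothesis): "every automorphism is a product `x ∘ c`". -/
def ConclusionUniversal : Prop := ∀ (m : ℕ) (ρ : S m ≃* S m), InGate m ρ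

/-- refuted by `ρ₀` (genus 3). -/
theorem not_conclusionUniversal : ¬ ConclusionUniversal := fun h => not_inGate_rho0 (h 0 rho0)

/-- STRENGTHENING 2 (one level suffices): congruence to a gate element modulo ONE characteristic
finite-index subgroup already forces gate membership. -/
def SingleLevelSuffices : Prop :=
  ∀ (m : ℕ) (ρ : S m ≃* S m) (M : Subgroup (S m)), M.Characteristic → M.FiniteIndex →
    InGateMod m ρ M → InGate m ρ

/-- refuted — contentfully — at the mod-2 homology level `M₂` by `ρ₁ = T_c²`. -/
theorem not_singleLevelSuffices : ¬ SingleLevelSuffices := fun h =>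
  not_inGate_rho1 (h 0 rho1 M2 M2_characteristic M2_finiteIndex inGateMod_rho1_M2)

/-- STRENGTHENING 3 (the mod-2 homology level suffices, pointwise form). -/
def LevelTwoSuffices : Prop :=
  ∀ ρ : SurfaceGroup 3 ≃* SurfaceGroup 3, (∀ s, ρ s * s⁻¹ ∈ M2) → InGate 0 ρ

theorem not_levelTwoSuffices : ¬ LevelTwoSuffices := fun h =>
  not_inGate_rho1 (h rho1 rho1_congr_M2)

/-! ### No level suffices at all: the gate has empty interior in the congruence topology (genus 3)

For EVERY characteristic finite-index `M ≤ S₃` there is an automorphism `≡ id (mod M)` outside the gate: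
a power `θ^{2d}` of the `(1,1)`-twist of handle 1, `d` the order of the permutation induced by `θ` on
the finite group `S₃/M`. The certificate is uniform: `S₃ → D_{2d+1}` (dihedral), `a₁ ↦ r 1`,
`b₂ ↦ sr 0`; indeed `S₃/(N₁ ⊔ θ^{k}N₂) = ⟨a₁, b₂ ∣ a₁^{k+1}⟩ ≅ ℤ/(k+1) ∗ ℤ` (lens-space summand
`L(k+1,1)`). -/

/-- `θ` as an element of the group `MulAut S₃` (to take powers). -/
def thetaAut : MulAut (SurfaceGroup 3) := theta

@[simp] theorem thetaAut_apply (s : SurfaceGroup 3) : thetaAut s = theta s := rfl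

theorem thetaAut_pow_a0 (k : ℕ) : (thetaAut ^ k) (a 0) = a 0 := by
  induction k with
  | zero => simp
  | succ k ih => rw [pow_succ, MulAut.mul_apply, thetaAut_apply, theta_a0, ih]

theorem thetaAut_pow_b0 (k : ℕ) : (thetaAut ^ k) (b 0) = b 0 := by
  induction k with
  | zero => simp
  | succ k ih => rw [pow_succ, MulAut.mul_apply, thetaAut_apply, theta_b0, ih]

theorem thetaAut_pow_a2 (k : ℕ) : (thetaAut ^ k) (a 2) = a 2 := by
  induction k with
  | zero => simp
  | succ k ih => rw [pow_succ, MulAut.mul_apply, thetaAut_apply, theta_a2, ih]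

theorem thetaAut_pow_b2 (k : ℕ) : (thetaAut ^ k) (b 2) = b 2 := by
  induction k with
  | zero => simp
  | succ k ih => rw [pow_succ, MulAut.mul_apply, thetaAut_apply, theta_b2, ih]

/-- generator images of the dihedral certificate: `a₁ ↦ r 1`, `b₂ ↦ sr 0`, all others `↦ 1` -/
def certDFun (n : ℕ) (p : surfaceGen 3) : DihedralGroup n :=
  if p = (1, false) then DihedralGroup.r 1 else if p = (2, true) then DihedralGroup.sr 0 else 1

theorem certDFun_rel (n : ℕ) : FreeGroup.lift (certDFun n) (surfaceRelator 3) = 1 := by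
  rw [lift_surfaceRelator_three]; simp [certDFun]

/-- the dihedral certificate hom `S₃ → D_n` -/
def certD (n : ℕ) : SurfaceGroup 3 →* DihedralGroup n := liftHom (certDFun n) (certDFun_rel n)

@[simp] theorem certD_a0 (n : ℕ) : certD n (a 0) = 1 := by simp [certD, certDFun]
@[simp] theorem certD_b0 (n : ℕ) : certD n (b 0) = 1 := by simp [certD, certDFun]
@[simp] theorem certD_a1 (n : ℕ) : certD n (a 1) = DihedralGroup.r 1 := by simp [certD, certDFun]
@[simp] theorem certD_b1 (n : ℕ) : certD n (b 1) = 1 := by simp [certD, certDFun]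
@[simp] theorem certD_a2 (n : ℕ) : certD n (a 2) = 1 := by simp [certD, certDFun]
@[simp] theorem certD_b2 (n : ℕ) : certD n (b 2) = DihedralGroup.sr 0 := by simp [certD, certDFun]

/-- the dihedral certificate along the orbit of `(a₁, b₁)` under powers of `θ`:
`θ^k(a₁) ↦ r (k+1)`, `θ^k(b₁) ↦ r (-k)` (all in the rotation subgroup). -/
theorem certD_thetaAut_pow (n k : ℕ) :
    certD n ((thetaAut ^ k) (a 1)) = DihedralGroup.r ((k : ZMod n) + 1) ∧
      certD n ((thetaAut ^ k) (b 1)) = DihedralGroup.r (-(k : ZMod n)) := by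
  induction k with
  | zero => simp
  | succ k ih =>
    obtain ⟨iha, ihb⟩ := ih
    refine ⟨?_, ?_⟩
    · rw [pow_succ, MulAut.mul_apply, thetaAut_apply, theta_a1]
      simp only [map_mul, iha, ihb, DihedralGroup.r_mul_r]
      congr 1
      push_cast
      ring
    · rw [pow_succ, MulAut.mul_apply, thetaAut_apply, theta_b1]
      simp only [map_inv, iha, DihedralGroup.inv_r]
      congr 1
      push_cast
      ring

/-- **No single level suffices, uniformly: the gate has empty interior in the congruence topology.**
For every characteristic finite-index `M ≤ S₃` there is `ρ ≡ id (mod M)` (pointwise) with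
`ρ ∉ (A∩B)·C`, namely `ρ = θ^{2d}` with `d` the order of `θ` acting on `S₃/M`. -/
theorem exists_congr_not_inGate (M : Subgroup (SurfaceGroup 3)) (hM : M.Characteristic)
    (hfi : M.FiniteIndex) :
    ∃ ρ : SurfaceGroup 3 ≃* SurfaceGroup 3, (∀ s, ρ s * s⁻¹ ∈ M) ∧ ¬ InGate 0 ρ := by
  haveI := hM
  haveI := hfi
  have hmap : M.map (theta : SurfaceGroup 3 →* SurfaceGroup 3) = M :=
    Subgroup.characteristic_iff_map_eq.1 hM theta
  let σ : SurfaceGroup 3 ⧸ M ≃* SurfaceGroup 3 ⧸ M := QuotientGroup.congr M M theta hmap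
  let τ : Equiv.Perm (SurfaceGroup 3 ⧸ M) := σ.toEquiv
  have hτ : ∀ (k : ℕ) (s : SurfaceGroup 3),
      (τ ^ k) (QuotientGroup.mk s) = QuotientGroup.mk ((thetaAut ^ k) s) := by
    intro k
    induction k with
    | zero => intro s; simp
    | succ k ih =>
      intro s
      rw [pow_succ', Equiv.Perm.mul_apply, ih, pow_succ', MulAut.mul_apply]
      rfl
  set d := orderOf τ with hd
  have hdpos : 0 < d := (isOfFinOrder_of_finite τ).orderOf_pos
  have hτd : τ ^ d = 1 := pow_orderOf_eq_one τ
  refine ⟨thetaAut ^ (2 * d), fun s => ?_, ?_⟩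
  · have h1 : (τ ^ (2 * d)) (QuotientGroup.mk s) = QuotientGroup.mk s := by
      rw [mul_comm, pow_mul, hτd, one_pow, Equiv.Perm.one_apply]
    rw [hτ] at h1
    rw [← div_eq_mul_inv, ← QuotientGroup.eq_iff_div_mem]
    exact h1
  · haveI : Fact (2 < 2 * d + 1) := ⟨by omega⟩
    refine not_inGate_zero_of_cert (thetaAut ^ (2 * d)) (certD (2 * d + 1)) (certD_a0 _) (certD_b1 _)
      (certD_a2 _) ?_ ?_ ?_ (a 1) (b 2) ?_
    · rw [thetaAut_pow_b0, certD_b0]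
    · rw [(certD_thetaAut_pow (2 * d + 1) (2 * d)).1, ← DihedralGroup.r_zero]
      congr 1
      have h := ZMod.natCast_self (2 * d + 1)
      push_cast at h ⊢
      linear_combination h
    · rw [thetaAut_pow_a2, certD_a2]
    · rw [certD_a1, certD_b2, DihedralGroup.r_mul_sr, DihedralGroup.sr_mul_r, zero_sub, zero_add, ne_eq,
        DihedralGroup.sr.injEq]
      exact ZMod.neg_one_ne_one

/-- STRENGTHENING 2′ (uniform form of 2): "SOME level suffices". -/
def SomeLevelSuffices : Prop :=
  ∃ M : Subgroup (SurfaceGroup 3), M.Characteristic ∧ M.FiniteIndex ∧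
    ∀ ρ : SurfaceGroup 3 ≃* SurfaceGroup 3, InGateMod 0 ρ M → InGate 0 ρ

/-- refuted: no level at all suffices. -/
theorem not_someLevelSuffices : ¬ SomeLevelSuffices := by
  rintro ⟨M, hM, hfi, h⟩
  obtain ⟨ρ, hρ, hnot⟩ := exists_congr_not_inGate M hM hfi
  exact hnot (h ρ ⟨MulEquiv.refl _, MulEquiv.refl _, by simp [Stab], by simp [Stab], by simp [Stab],
    fun s => by simpa using hρ s⟩)


/-! ## Handle-mixing twists and a Johnson-kernel witness (genus 3)

The automorphisms below were FOUND by a Whitehead-graph search for stabilisers of the cyclic word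
`[a₀,b₀][a₁,b₁]` in `Aut F₄` (py/whitehead.py in the seat folder) and normalised by a partial
conjugation; every identity used is a free-group identity, re-verified here by `group`. -/

open scoped commutatorElement

/-- generator images of `ta` -/
def taFun (p : surfaceGen 3) : SurfaceGroup 3 :=
  if p = ((0, false) : surfaceGen 3) then (a 1)⁻¹ * a 0 * a 1
  else if p = ((0, true) : surfaceGen 3) then (a 1)⁻¹ * (a 0)⁻¹ * a 1 * a 0 * b 0 * a 0 * a 1
  else if p = ((1, false) : surfaceGen 3) then (a 1)⁻¹ * (a 0)⁻¹ * a 1 * a 0 * a 1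
  else if p = ((1, true) : surfaceGen 3) then b 1 * a 0 * a 1
  else PresentedGroup.of p

/-- generator images of `taInv` -/
def taInvFun (p : surfaceGen 3) : SurfaceGroup 3 :=
  if p = ((0, false) : surfaceGen 3) then a 0 * a 1 * a 0 * (a 1)⁻¹ * (a 0)⁻¹
  else if p = ((0, true) : surfaceGen 3) then a 0 * a 1 * (a 0)⁻¹ * (a 1)⁻¹ * b 0 * (a 1)⁻¹ * (a 0)⁻¹
  else if p = ((1, false) : surfaceGen 3) then a 0 * a 1 * (a 0)⁻¹
  else if p = ((1, true) : surfaceGen 3) then b 1 * (a 1)⁻¹ * (a 0)⁻¹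
  else PresentedGroup.of p

theorem taFun_rel : FreeGroup.lift taFun (surfaceRelator 3) = 1 := by
  rw [lift_surfaceRelator_three, ← rel_three]
  simp [taFun, of_false, of_true]
  group

theorem taInvFun_rel : FreeGroup.lift taInvFun (surfaceRelator 3) = 1 := by
  rw [lift_surfaceRelator_three, ← rel_three]
  simp [taInvFun, of_false, of_true]
  group

/-- `TA` as a hom -/
def taHom : SurfaceGroup 3 →* SurfaceGroup 3 := liftHom taFun taFun_rel
/-- `TA⁻¹` as a hom -/
def taInvHom : SurfaceGroup 3 →* SurfaceGroup 3 := liftHom taInvFun taInvFun_rel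

theorem taInv_comp : taInvHom.comp taHom = MonoidHom.id _ := by
  apply PresentedGroup.ext
  rintro ⟨i, _ | _⟩ <;> fin_cases i <;>
    simp [taHom, taInvHom, taFun, taInvFun, of_false, of_true]
  all_goals group

theorem ta_comp_inv : taHom.comp taInvHom = MonoidHom.id _ := by
  apply PresentedGroup.ext
  rintro ⟨i, _ | _⟩ <;> fin_cases i <;>
    simp [taHom, taInvHom, taFun, taInvFun, of_false, of_true]
  all_goals group

/-- **`TA ∈ Aut S₃`**: the Dehn twist along a curve of class `a₀ + a₁` joining handles 0 and 1, normalised by a partial conjugation so that it fixes `[a₀,b₀][a₁,b₁]` on the nose. -/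
def TA : SurfaceGroup 3 ≃* SurfaceGroup 3 := MonoidHom.toMulEquiv taHom taInvHom taInv_comp ta_comp_inv

@[simp] theorem TA_a0 : TA (a 0) = (a 1)⁻¹ * a 0 * a 1 := by
  simp [TA, taHom, taFun]
@[simp] theorem TA_symm_a0 : TA.symm (a 0) = a 0 * a 1 * a 0 * (a 1)⁻¹ * (a 0)⁻¹ := by
  simp [TA, taInvHom, taInvFun]
@[simp] theorem TA_b0 : TA (b 0) = (a 1)⁻¹ * (a 0)⁻¹ * a 1 * a 0 * b 0 * a 0 * a 1 := by
  simp [TA, taHom, taFun]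
@[simp] theorem TA_symm_b0 : TA.symm (b 0) = a 0 * a 1 * (a 0)⁻¹ * (a 1)⁻¹ * b 0 * (a 1)⁻¹ * (a 0)⁻¹ := by
  simp [TA, taInvHom, taInvFun]
@[simp] theorem TA_a1 : TA (a 1) = (a 1)⁻¹ * (a 0)⁻¹ * a 1 * a 0 * a 1 := by
  simp [TA, taHom, taFun]
@[simp] theorem TA_symm_a1 : TA.symm (a 1) = a 0 * a 1 * (a 0)⁻¹ := by
  simp [TA, taInvHom, taInvFun]
@[simp] theorem TA_b1 : TA (b 1) = b 1 * a 0 * a 1 := by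
  simp [TA, taHom, taFun]
@[simp] theorem TA_symm_b1 : TA.symm (b 1) = b 1 * (a 1)⁻¹ * (a 0)⁻¹ := by
  simp [TA, taInvHom, taInvFun]
@[simp] theorem TA_a2 : TA (a 2) = a 2 := by
  simp [TA, taHom, taFun, of_false]
@[simp] theorem TA_symm_a2 : TA.symm (a 2) = a 2 := by
  simp [TA, taInvHom, taInvFun, of_false]
@[simp] theorem TA_b2 : TA (b 2) = b 2 := by
  simp [TA, taHom, taFun, of_true]
@[simp] theorem TA_symm_b2 : TA.symm (b 2) = b 2 := by
  simp [TA, taInvHom, taInvFun, of_true]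

/-- generator images of `tb` -/
def tbFun (p : surfaceGen 3) : SurfaceGroup 3 :=
  if p = ((0, false) : surfaceGen 3) then a 0 * b 1 * b 0
  else if p = ((0, true) : surfaceGen 3) then (b 0)⁻¹ * (b 1)⁻¹ * b 0 * b 1 * b 0
  else if p = ((1, false) : surfaceGen 3) then (b 0)⁻¹ * (b 1)⁻¹ * b 0 * b 1 * a 1 * b 1 * b 0
  else if p = ((1, true) : surfaceGen 3) then (b 0)⁻¹ * b 1 * b 0
  else PresentedGroup.of p

/-- generator images of `tbInv` -/
def tbInvFun (p : surfaceGen 3) : SurfaceGroup 3 :=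
  if p = ((0, false) : surfaceGen 3) then a 0 * (b 0)⁻¹ * (b 1)⁻¹
  else if p = ((0, true) : surfaceGen 3) then b 1 * b 0 * (b 1)⁻¹
  else if p = ((1, false) : surfaceGen 3) then b 1 * b 0 * (b 1)⁻¹ * (b 0)⁻¹ * a 1 * (b 0)⁻¹ * (b 1)⁻¹
  else if p = ((1, true) : surfaceGen 3) then b 1 * b 0 * b 1 * (b 0)⁻¹ * (b 1)⁻¹
  else PresentedGroup.of p

theorem tbFun_rel : FreeGroup.lift tbFun (surfaceRelator 3) = 1 := by
  rw [lift_surfaceRelator_three, ← rel_three]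
  simp [tbFun, of_false, of_true]
  group

theorem tbInvFun_rel : FreeGroup.lift tbInvFun (surfaceRelator 3) = 1 := by
  rw [lift_surfaceRelator_three, ← rel_three]
  simp [tbInvFun, of_false, of_true]
  group

/-- `TB` as a hom -/
def tbHom : SurfaceGroup 3 →* SurfaceGroup 3 := liftHom tbFun tbFun_rel
/-- `TB⁻¹` as a hom -/
def tbInvHom : SurfaceGroup 3 →* SurfaceGroup 3 := liftHom tbInvFun tbInvFun_rel

theorem tbInv_comp : tbInvHom.comp tbHom = MonoidHom.id _ := by
  apply PresentedGroup.ext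
  rintro ⟨i, _ | _⟩ <;> fin_cases i <;>
    simp [tbHom, tbInvHom, tbFun, tbInvFun, of_false, of_true]
  all_goals group

theorem tb_comp_inv : tbHom.comp tbInvHom = MonoidHom.id _ := by
  apply PresentedGroup.ext
  rintro ⟨i, _ | _⟩ <;> fin_cases i <;>
    simp [tbHom, tbInvHom, tbFun, tbInvFun, of_false, of_true]
  all_goals group

/-- **`TB ∈ Aut S₃`**: the Dehn twist along a curve of class `b₀ + b₁` joining handles 0 and 1, normalised likewise. -/
def TB : SurfaceGroup 3 ≃* SurfaceGroup 3 := MonoidHom.toMulEquiv tbHom tbInvHom tbInv_comp tb_comp_inv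

@[simp] theorem TB_a0 : TB (a 0) = a 0 * b 1 * b 0 := by
  simp [TB, tbHom, tbFun]
@[simp] theorem TB_symm_a0 : TB.symm (a 0) = a 0 * (b 0)⁻¹ * (b 1)⁻¹ := by
  simp [TB, tbInvHom, tbInvFun]
@[simp] theorem TB_b0 : TB (b 0) = (b 0)⁻¹ * (b 1)⁻¹ * b 0 * b 1 * b 0 := by
  simp [TB, tbHom, tbFun]
@[simp] theorem TB_symm_b0 : TB.symm (b 0) = b 1 * b 0 * (b 1)⁻¹ := by
  simp [TB, tbInvHom, tbInvFun]
@[simp] theorem TB_a1 : TB (a 1) = (b 0)⁻¹ * (b 1)⁻¹ * b 0 * b 1 * a 1 * b 1 * b 0 := by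
  simp [TB, tbHom, tbFun]
@[simp] theorem TB_symm_a1 : TB.symm (a 1) = b 1 * b 0 * (b 1)⁻¹ * (b 0)⁻¹ * a 1 * (b 0)⁻¹ * (b 1)⁻¹ := by
  simp [TB, tbInvHom, tbInvFun]
@[simp] theorem TB_b1 : TB (b 1) = (b 0)⁻¹ * b 1 * b 0 := by
  simp [TB, tbHom, tbFun]
@[simp] theorem TB_symm_b1 : TB.symm (b 1) = b 1 * b 0 * b 1 * (b 0)⁻¹ * (b 1)⁻¹ := by
  simp [TB, tbInvHom, tbInvFun]
@[simp] theorem TB_a2 : TB (a 2) = a 2 := by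
  simp [TB, tbHom, tbFun, of_false]
@[simp] theorem TB_symm_a2 : TB.symm (a 2) = a 2 := by
  simp [TB, tbInvHom, tbInvFun, of_false]
@[simp] theorem TB_b2 : TB (b 2) = b 2 := by
  simp [TB, tbHom, tbFun, of_true]
@[simp] theorem TB_symm_b2 : TB.symm (b 2) = b 2 := by
  simp [TB, tbInvHom, tbInvFun, of_true]

/-- generator images of `p0` -/
def p0Fun (p : surfaceGen 3) : SurfaceGroup 3 :=
  if p = ((0, false) : surfaceGen 3) then a 0 * b 0 * (a 0)⁻¹ * (b 0)⁻¹ * a 0 * b 0 * a 0 * (b 0)⁻¹ * (a 0)⁻¹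
  else if p = ((0, true) : surfaceGen 3) then a 0 * b 0 * (a 0)⁻¹ * b 0 * a 0 * (b 0)⁻¹ * (a 0)⁻¹
  else if p = ((1, false) : surfaceGen 3) then a 1
  else if p = ((1, true) : surfaceGen 3) then b 1
  else PresentedGroup.of p

/-- generator images of `p0Inv` -/
def p0InvFun (p : surfaceGen 3) : SurfaceGroup 3 :=
  if p = ((0, false) : surfaceGen 3) then b 0 * a 0 * (b 0)⁻¹ * a 0 * b 0 * (a 0)⁻¹ * (b 0)⁻¹
  else if p = ((0, true) : surfaceGen 3) then b 0 * a 0 * (b 0)⁻¹ * (a 0)⁻¹ * b 0 * a 0 * b 0 * (a 0)⁻¹ * (b 0)⁻¹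
  else if p = ((1, false) : surfaceGen 3) then a 1
  else if p = ((1, true) : surfaceGen 3) then b 1
  else PresentedGroup.of p

theorem p0Fun_rel : FreeGroup.lift p0Fun (surfaceRelator 3) = 1 := by
  rw [lift_surfaceRelator_three, ← rel_three]
  simp [p0Fun, of_false, of_true]
  group

theorem p0InvFun_rel : FreeGroup.lift p0InvFun (surfaceRelator 3) = 1 := by
  rw [lift_surfaceRelator_three, ← rel_three]
  simp [p0InvFun, of_false, of_true]
  group

/-- `P0` as a hom -/
def p0Hom : SurfaceGroup 3 →* SurfaceGroup 3 := liftHom p0Fun p0Fun_rel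
/-- `P0⁻¹` as a hom -/
def p0InvHom : SurfaceGroup 3 →* SurfaceGroup 3 := liftHom p0InvFun p0InvFun_rel

theorem p0Inv_comp : p0InvHom.comp p0Hom = MonoidHom.id _ := by
  apply PresentedGroup.ext
  rintro ⟨i, _ | _⟩ <;> fin_cases i <;>
    simp [p0Hom, p0InvHom, p0Fun, p0InvFun, of_false, of_true]
  all_goals group

theorem p0_comp_inv : p0Hom.comp p0InvHom = MonoidHom.id _ := by
  apply PresentedGroup.ext
  rintro ⟨i, _ | _⟩ <;> fin_cases i <;>
    simp [p0Hom, p0InvHom, p0Fun, p0InvFun, of_false, of_true]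
  all_goals group

/-- **`P0 ∈ Aut S₃`**: the separating twist `T_{δ₀}` about `∂(handle 0)`: partial conjugation of handle 0 by `δ₀ = [a₀,b₀]` (Johnson kernel). -/
def P0 : SurfaceGroup 3 ≃* SurfaceGroup 3 := MonoidHom.toMulEquiv p0Hom p0InvHom p0Inv_comp p0_comp_inv

@[simp] theorem P0_a0 : P0 (a 0) = a 0 * b 0 * (a 0)⁻¹ * (b 0)⁻¹ * a 0 * b 0 * a 0 * (b 0)⁻¹ * (a 0)⁻¹ := by
  simp [P0, p0Hom, p0Fun]
@[simp] theorem P0_symm_a0 : P0.symm (a 0) = b 0 * a 0 * (b 0)⁻¹ * a 0 * b 0 * (a 0)⁻¹ * (b 0)⁻¹ := by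
  simp [P0, p0InvHom, p0InvFun]
@[simp] theorem P0_b0 : P0 (b 0) = a 0 * b 0 * (a 0)⁻¹ * b 0 * a 0 * (b 0)⁻¹ * (a 0)⁻¹ := by
  simp [P0, p0Hom, p0Fun]
@[simp] theorem P0_symm_b0 : P0.symm (b 0) = b 0 * a 0 * (b 0)⁻¹ * (a 0)⁻¹ * b 0 * a 0 * b 0 * (a 0)⁻¹ * (b 0)⁻¹ := by
  simp [P0, p0InvHom, p0InvFun]
@[simp] theorem P0_a1 : P0 (a 1) = a 1 := by
  simp [P0, p0Hom, p0Fun]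
@[simp] theorem P0_symm_a1 : P0.symm (a 1) = a 1 := by
  simp [P0, p0InvHom, p0InvFun]
@[simp] theorem P0_b1 : P0 (b 1) = b 1 := by
  simp [P0, p0Hom, p0Fun]
@[simp] theorem P0_symm_b1 : P0.symm (b 1) = b 1 := by
  simp [P0, p0InvHom, p0InvFun]
@[simp] theorem P0_a2 : P0 (a 2) = a 2 := by
  simp [P0, p0Hom, p0Fun, of_false]
@[simp] theorem P0_symm_a2 : P0.symm (a 2) = a 2 := by
  simp [P0, p0InvHom, p0InvFun, of_false]
@[simp] theorem P0_b2 : P0 (b 2) = b 2 := by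
  simp [P0, p0Hom, p0Fun, of_true]
@[simp] theorem P0_symm_b2 : P0.symm (b 2) = b 2 := by
  simp [P0, p0InvHom, p0InvFun, of_true]

/-- `ψ = T_B ∘ T_A⁻¹` -/
def psi : SurfaceGroup 3 ≃* SurfaceGroup 3 := TA.symm.trans TB

/-- **`ρ₂ = ψ ∘ T_{δ₀} ∘ ψ⁻¹ = T_{ψ(δ₀)}`**: the Dehn twist about the genus-1 separating curve
`ψ(∂ handle 0)`. It lies in the JOHNSON KERNEL (acts trivially on `S₃/γ₃S₃`, `rho2_congr_gamma3`),
in particular in the Torelli group, yet `ρ₂ ∉ (A∩B)·C` (`not_inGate_rho2`): the 3-manifold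
`H_{N₀} ∪ H_{ρ₂N₂}` is a homology `S¹×S²` whose group maps onto `Sym(3)`. -/
def rho2 : SurfaceGroup 3 ≃* SurfaceGroup 3 := (psi.symm.trans P0).trans psi

theorem rho2_apply (s : SurfaceGroup 3) : rho2 s = TB (TA.symm (P0 (TA (TB.symm s)))) := by
  simp [rho2, psi]

/-! ### Certificate for `ρ₂` via the pair `(N₀, ρ₂N₂)`: `b₀ ↦ (0 1 2)`, `b₁ ↦ (1 2)`, others `↦ 1` -/

/-- generator images of the certificate hom for `ρ₂` -/
def cert2Fun (p : surfaceGen 3) : Equiv.Perm (Fin 3) :=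
  if p = (0, true) then finRotate 3 else if p = (1, true) then Equiv.swap 1 2 else 1

theorem cert2Fun_rel : FreeGroup.lift cert2Fun (surfaceRelator 3) = 1 := by
  rw [lift_surfaceRelator_three]; simp [cert2Fun]

/-- certificate hom for `ρ₂` -/
def cert2 : SurfaceGroup 3 →* Equiv.Perm (Fin 3) := liftHom cert2Fun cert2Fun_rel

@[simp] theorem cert2_a0 : cert2 (a 0) = 1 := by simp [cert2, cert2Fun]
@[simp] theorem cert2_b0 : cert2 (b 0) = finRotate 3 := by simp [cert2, cert2Fun]
@[simp] theorem cert2_a1 : cert2 (a 1) = 1 := by simp [cert2, cert2Fun]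
@[simp] theorem cert2_b1 : cert2 (b 1) = Equiv.swap 1 2 := by simp [cert2, cert2Fun]
@[simp] theorem cert2_a2 : cert2 (a 2) = 1 := by simp [cert2, cert2Fun]
@[simp] theorem cert2_b2 : cert2 (b 2) = 1 := by simp [cert2, cert2Fun]

theorem st1_a0 : cert2 (TB (a 0)) = Equiv.swap 0 2 := by
  simp only [TB_a0, map_mul, cert2_a0, cert2_b1, cert2_b0]
  decide
theorem st1_b0 : cert2 (TB (b 0)) = (finRotate 3)⁻¹ := by
  simp only [TB_b0, map_mul, map_inv, cert2_b0, cert2_b1]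
  decide
theorem st1_a1 : cert2 (TB (a 1)) = Equiv.swap 1 2 := by
  simp only [TB_a1, map_mul, map_inv, cert2_b0, cert2_b1, cert2_a1]
  decide
theorem st1_b1 : cert2 (TB (b 1)) = Equiv.swap 0 1 := by
  simp only [TB_b1, map_mul, map_inv, cert2_b0, cert2_b1]
  decide
theorem st1_a2 : cert2 (TB (a 2)) = 1 := by
  simp only [TB_a2, cert2_a2]
theorem st1_b2 : cert2 (TB (b 2)) = 1 := by
  simp only [TB_b2, cert2_b2]

theorem st2_a0 : cert2 (TB (TA.symm (a 0))) = Equiv.swap 1 2 := by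
  simp only [TA_symm_a0, map_mul, map_inv, st1_a0, st1_a1]
  decide
theorem st2_b0 : cert2 (TB (TA.symm (b 0))) = finRotate 3 := by
  simp only [TA_symm_b0, map_mul, map_inv, st1_a0, st1_a1, st1_b0]
  decide
theorem st2_a1 : cert2 (TB (TA.symm (a 1))) = Equiv.swap 0 1 := by
  simp only [TA_symm_a1, map_mul, map_inv, st1_a0, st1_a1]
  decide
theorem st2_b1 : cert2 (TB (TA.symm (b 1))) = Equiv.swap 1 2 := by
  simp only [TA_symm_b1, map_mul, map_inv, st1_b1, st1_a1, st1_a0]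
  decide
theorem st2_a2 : cert2 (TB (TA.symm (a 2))) = 1 := by
  simp only [TA_symm_a2, st1_a2]
theorem st2_b2 : cert2 (TB (TA.symm (b 2))) = 1 := by
  simp only [TA_symm_b2, st1_b2]

theorem st3_a0 : cert2 (TB (TA.symm (P0 (a 0)))) = Equiv.swap 0 2 := by
  simp only [P0_a0, map_mul, map_inv, st2_a0, st2_b0]
  decide
theorem st3_b0 : cert2 (TB (TA.symm (P0 (b 0)))) = finRotate 3 := by
  simp only [P0_b0, map_mul, map_inv, st2_a0, st2_b0]
  decide
theorem st3_a1 : cert2 (TB (TA.symm (P0 (a 1)))) = Equiv.swap 0 1 := by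
  simp only [P0_a1, st2_a1]
theorem st3_b1 : cert2 (TB (TA.symm (P0 (b 1)))) = Equiv.swap 1 2 := by
  simp only [P0_b1, st2_b1]
theorem st3_a2 : cert2 (TB (TA.symm (P0 (a 2)))) = 1 := by
  simp only [P0_a2, st2_a2]
theorem st3_b2 : cert2 (TB (TA.symm (P0 (b 2)))) = 1 := by
  simp only [P0_b2, st2_b2]

theorem st4_a0 : cert2 (TB (TA.symm (P0 (TA (a 0))))) = Equiv.swap 1 2 := by
  simp only [TA_a0, map_mul, map_inv, st3_a1, st3_a0]
  decide
theorem st4_b0 : cert2 (TB (TA.symm (P0 (TA (b 0))))) = 1 := by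
  simp only [TA_b0, map_mul, map_inv, st3_a1, st3_a0, st3_b0]
  decide
theorem st4_a1 : cert2 (TB (TA.symm (P0 (TA (a 1))))) = Equiv.swap 0 2 := by
  simp only [TA_a1, map_mul, map_inv, st3_a1, st3_a0]
  decide
theorem st4_b1 : cert2 (TB (TA.symm (P0 (TA (b 1))))) = Equiv.swap 0 2 := by
  simp only [TA_b1, map_mul, st3_b1, st3_a0, st3_a1]
  decide
theorem st4_a2 : cert2 (TB (TA.symm (P0 (TA (a 2))))) = 1 := by
  simp only [TA_a2, st3_a2]
theorem st4_b2 : cert2 (TB (TA.symm (P0 (TA (b 2))))) = 1 := by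
  simp only [TA_b2, st3_b2]

theorem st5_a0 : cert2 (TB (TA.symm (P0 (TA (TB.symm (a 0)))))) = finRotate 3 := by
  simp only [TB_symm_a0, map_mul, map_inv, st4_a0, st4_b0, st4_b1]
  decide
theorem st5_b0 : cert2 (TB (TA.symm (P0 (TA (TB.symm (b 0)))))) = 1 := by
  simp only [TB_symm_b0, map_mul, map_inv, st4_b1, st4_b0]
  decide
theorem st5_a1 : cert2 (TB (TA.symm (P0 (TA (TB.symm (a 1)))))) = 1 := by
  simp only [TB_symm_a1, map_mul, map_inv, st4_b1, st4_b0, st4_a1]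
  decide
theorem st5_b1 : cert2 (TB (TA.symm (P0 (TA (TB.symm (b 1)))))) = Equiv.swap 0 2 := by
  simp only [TB_symm_b1, map_mul, map_inv, st4_b1, st4_b0]
  decide
theorem st5_a2 : cert2 (TB (TA.symm (P0 (TA (TB.symm (a 2)))))) = 1 := by
  simp only [TB_symm_a2, st4_a2]
theorem st5_b2 : cert2 (TB (TA.symm (P0 (TA (TB.symm (b 2)))))) = 1 := by
  simp only [TB_symm_b2, st4_b2]

/-! ### `ρ₂` is not in the gate -/

/-- at genus 3, a hom killing `a₀, b₀, a₁, a₂, b₂` (i.e. `N₀ ⊔ N₂`) has abelian image -/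
theorem commute_of_kills0 {Q : Type*} [Group Q] (φ : SurfaceGroup 3 →* Q)
    (h1 : φ (a 0) = 1) (h2 : φ (b 0) = 1) (h3 : φ (a 1) = 1) (h4 : φ (a 2) = 1) (h5 : φ (b 2) = 1)
    (s t : SurfaceGroup 3) : φ s * φ t = φ t * φ s := by
  let ε : SurfaceGroup 3 →* Multiplicative ℤ :=
    SurfaceGroup.toCommGroup (fun p => if p = ((1 : Fin 3), true) then Multiplicative.ofAdd 1 else 1)
  have hφ : φ = (zpowersHom Q (φ (b 1))).comp ε := by
    apply PresentedGroup.ext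
    rintro ⟨i, _ | _⟩ <;> fin_cases i <;>
      simp [ε, of_false, of_true, h1, h2, h3, h4, h5]
  rw [hφ]
  simp only [MonoidHom.comp_apply, zpowersHom_apply]
  exact zpow_mul_comm _ _ _

theorem a_mem_s4Kernels_zero : (a 0 : SurfaceGroup 3) ∈ s4Kernels 0 :=
  subset_normalClosure (by simp)
theorem a_one_mem_s4Kernels_zero : (a 1 : SurfaceGroup 3) ∈ s4Kernels 0 :=
  subset_normalClosure (by simp)
theorem b_two_mem_s4Kernels_zero : (b 2 : SurfaceGroup 3) ∈ s4Kernels 0 :=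
  subset_normalClosure (by simp)

/-- **Non-gate certificate via the pair `(N₀, ρN₂)` (genus 3).** A hom `f : S₃ → Q` killing the
generators `a₀, a₁, b₂` of `N₀` and `ρ b₀, ρ a₁, ρ a₂` of `ρ N₂`, with two non-commuting values,
shows `ρ ∉ (Stab N₀ ∩ Stab N₁)·Stab N₂` (as `S₃ ⧸ (N₀ ⊔ N₂) = ⟨b₁⟩ ≅ ℤ` is abelian). -/
theorem not_inGate_zero_of_cert0 {Q : Type*} [Group Q] (ρ : SurfaceGroup 3 ≃* SurfaceGroup 3)
    (f : SurfaceGroup 3 →* Q) (hf0 : f (a 0) = 1) (hf1 : f (a 1) = 1) (hf2 : f (b 2) = 1)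
    (hρ0 : f (ρ (b 0)) = 1) (hρ1 : f (ρ (a 1)) = 1) (hρ2 : f (ρ (a 2)) = 1)
    (s t : SurfaceGroup 3) (hne : f s * f t ≠ f t * f s) : ¬ InGate 0 ρ := by
  intro h
  obtain ⟨x, h0, -, h2⟩ := (inGate_iff 0 ρ).1 h
  change (s4Kernels 0).map x.toMonoidHom = s4Kernels 0 at h0
  change (s4Kernels 2).map x.toMonoidHom = (s4Kernels 2).map ρ.toMonoidHom at h2
  have k0 : s4Kernels 0 ≤ f.ker := by
    refine normalClosure_le_normal ?_
    rintro _ (rfl | rfl | rfl) <;> simpa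
  have k2 : (s4Kernels 2).map ρ.toMonoidHom ≤ f.ker := by
    rw [show s4Kernels 2 = normalClosure {b 0, a 1, a 2} from rfl, map_normalClosure _ _ ρ.surjective]
    refine normalClosure_le_normal ?_
    rintro _ ⟨_, (rfl | rfl | rfl), rfl⟩ <;> simpa
  have viaN0 : ∀ g ∈ s4Kernels 0, f (x g) = 1 := fun g hg =>
    k0 (h0.le (mem_map_of_mem x.toMonoidHom hg))
  have viaN2 : ∀ g ∈ s4Kernels 2, f (x g) = 1 := fun g hg =>
    k2 (h2.le (mem_map_of_mem x.toMonoidHom hg))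
  have comm := commute_of_kills0 (f.comp x.toMonoidHom)
    (viaN0 _ a_mem_s4Kernels_zero) (viaN2 _ b_mem_s4Kernels_two) (viaN0 _ a_one_mem_s4Kernels_zero)
    (viaN2 _ a_two_mem_s4Kernels_two) (viaN0 _ b_two_mem_s4Kernels_zero) (x.symm s) (x.symm t)
  exact hne (by simpa using comm)

/-- **`ρ₂ ∉ (A∩B)·C`** (certificate `cert2` into `Sym(3)`). -/
theorem not_inGate_rho2 : ¬ InGate 0 rho2 := by
  refine not_inGate_zero_of_cert0 rho2 cert2 cert2_a0 cert2_a1 cert2_b2 ?_ ?_ ?_ (b 0) (b 1) ?_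
  · rw [rho2_apply]; exact st5_b0
  · rw [rho2_apply]; exact st5_a1
  · rw [rho2_apply]; exact st5_a2
  · rw [cert2_b0, cert2_b1]; decide

/-! ### `ρ₂` lies in the Johnson kernel: `ρ₂ ≡ id (mod γ₃ S₃)` -/

/-- `γ₃(S₃) = [[S₃,S₃],S₃]`, the third term of the lower central series. -/
abbrev Gamma3 : Subgroup (SurfaceGroup 3) := (⊤ : Subgroup (SurfaceGroup 3)).lowerCentralSeries 2

/-- `T_{δ₀}` acts trivially modulo `γ₃`: `T_{δ₀}(g) g⁻¹ = [δ₀, g] ∈ [γ₂, S₃]`. -/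
theorem p0_congr_gamma3 (s : SurfaceGroup 3) : P0 s * s⁻¹ ∈ Gamma3 := by
  suffices h : (QuotientGroup.mk' Gamma3).comp P0.toMonoidHom = QuotientGroup.mk' Gamma3 by
    have := DFunLike.congr_fun h s
    simp only [MonoidHom.comp_apply, MulEquiv.coe_toMonoidHom, QuotientGroup.mk'_apply] at this
    rw [QuotientGroup.eq_iff_div_mem, div_eq_mul_inv] at this
    exact this
  have hδ : ⁅(a 0 : SurfaceGroup 3), (b 0 : SurfaceGroup 3)⁆ ∈
      (⊤ : Subgroup (SurfaceGroup 3)).lowerCentralSeries 1 :=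
    Subgroup.commutator_mem_commutator (Subgroup.mem_top (a 0 : SurfaceGroup 3))
      (Subgroup.mem_top (b 0 : SurfaceGroup 3))
  have ha : P0 (a 0) / a 0 ∈ Gamma3 := by
    have e : P0 (a 0) / a 0 =
        ⁅⁅(a 0 : SurfaceGroup 3), (b 0 : SurfaceGroup 3)⁆, (a 0 : SurfaceGroup 3)⁆ := by
      rw [P0_a0]
      simp only [commutatorElement_def, div_eq_mul_inv]
      group
    rw [e]
    exact Subgroup.commutator_mem_commutator hδ (Subgroup.mem_top _)
  have hb : P0 (b 0) / b 0 ∈ Gamma3 := by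
    have e : P0 (b 0) / b 0 =
        ⁅⁅(a 0 : SurfaceGroup 3), (b 0 : SurfaceGroup 3)⁆, (b 0 : SurfaceGroup 3)⁆ := by
      rw [P0_b0]
      simp only [commutatorElement_def, div_eq_mul_inv]
      group
    rw [e]
    exact Subgroup.commutator_mem_commutator hδ (Subgroup.mem_top _)
  apply PresentedGroup.ext
  rintro ⟨i, _ | _⟩ <;> fin_cases i <;>
    simp only [MonoidHom.comp_apply, MulEquiv.coe_toMonoidHom, QuotientGroup.mk'_apply,
      QuotientGroup.eq_iff_div_mem] <;>
    simp [of_false, of_true]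
  · simpa using ha
  · simpa using hb

/-- conjugation transports pointwise congruence modulo a characteristic subgroup -/
theorem congr_conj {Γ : Subgroup (SurfaceGroup 3)} [hΓ : Γ.Characteristic]
    (P φ : SurfaceGroup 3 ≃* SurfaceGroup 3) (hP : ∀ t, P t * t⁻¹ ∈ Γ) (s : SurfaceGroup 3) :
    φ (P (φ.symm s)) * s⁻¹ ∈ Γ := by
  have h := hP (φ.symm s)
  have e : φ (P (φ.symm s)) * s⁻¹ = φ (P (φ.symm s) * (φ.symm s)⁻¹) := by simp
  rw [e]
  have hmap : Γ.map φ.toMonoidHom = Γ := Subgroup.characteristic_iff_map_eq.1 hΓ φ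
  exact hmap.le (Subgroup.mem_map_of_mem φ.toMonoidHom h)

/-- **`ρ₂` is in the Johnson kernel**: `ρ₂ s · s⁻¹ ∈ γ₃(S₃)` for every `s`. -/
theorem rho2_congr_gamma3 (s : SurfaceGroup 3) : rho2 s * s⁻¹ ∈ Gamma3 :=
  congr_conj (Γ := Gamma3) P0 psi p0_congr_gamma3 s

/-- hence `ρ₂` is in the Torelli group: `ρ₂ s · s⁻¹ ∈ [S₃,S₃]`. -/
theorem rho2_congr_commutator (s : SurfaceGroup 3) : rho2 s * s⁻¹ ∈ commutator (SurfaceGroup 3) := by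
  have h : Gamma3 ≤ (⊤ : Subgroup (SurfaceGroup 3)).lowerCentralSeries 1 :=
    Subgroup.lowerCentralSeries_antitone ⊤ (by norm_num : 1 ≤ 2)
  exact h (rho2_congr_gamma3 s)

/-! ### Refuted strengthenings: Torelli / Johnson-kernel / class-≤2 levels do not suffice -/

/-- STRENGTHENING 4: congruence modulo the commutator subgroup (all ABELIAN levels at once). -/
def TorelliSuffices : Prop :=
  ∀ ρ : SurfaceGroup 3 ≃* SurfaceGroup 3, (∀ s, ρ s * s⁻¹ ∈ commutator (SurfaceGroup 3)) → InGate 0 ρ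

theorem not_torelliSuffices : ¬ TorelliSuffices := fun h => not_inGate_rho2 (h rho2 rho2_congr_commutator)

/-- STRENGTHENING 5: congruence modulo `γ₃` (all levels with CLASS-2 NILPOTENT quotient at once). -/
def JohnsonKernelSuffices : Prop :=
  ∀ ρ : SurfaceGroup 3 ≃* SurfaceGroup 3,
    (∀ s, ρ s * s⁻¹ ∈ (⊤ : Subgroup (SurfaceGroup 3)).lowerCentralSeries 2) → InGate 0 ρ

theorem not_johnsonKernelSuffices : ¬ JohnsonKernelSuffices := fun h =>
  not_inGate_rho2 (h rho2 rho2_congr_gamma3)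

/-- STRENGTHENING 6 (level form): the crux hypothesis restricted to the characteristic finite-index
levels `M ⊇ γ₃(S₃)` (all finite quotients of nilpotency class ≤ 2) already forces the conclusion. -/
def ClassTwoLevelsSuffice : Prop :=
  ∀ ρ : SurfaceGroup 3 ≃* SurfaceGroup 3,
    (∀ M : Subgroup (SurfaceGroup 3), M.Characteristic → M.FiniteIndex →
      (⊤ : Subgroup (SurfaceGroup 3)).lowerCentralSeries 2 ≤ M → InGateMod 0 ρ M) → InGate 0 ρ

theorem not_classTwoLevelsSuffice : ¬ ClassTwoLevelsSuffice := fun h =>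
  not_inGate_rho2 (h rho2 fun M _ _ hM =>
    ⟨MulEquiv.refl _, MulEquiv.refl _, by simp [Stab], by simp [Stab], by simp [Stab],
      fun s => hM (by simpa using rho2_congr_gamma3 s)⟩)

end GenusThree


end Summit.SmoothPoincare4.SmoothPoincare4.Cruxes.HeegaardHandlebodyCongruenceClosed.Disproof
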